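import Literature.Analysis.FluidPDE.QuasiSelfSimilarGenerators
import HarnessLib

/-!
# The Peano-snake figures of Alberti–Crippa–Mazzucato transcribed (JAMS 32 (2019), §8.9–8.11,
Figs. 9–12 = `fig8d`, `fig8e`, `fig8f`, `fig8g` of arXiv:1605.02090v4)

Topic `Literature/Analysis/FluidPDE`. The discharge of the kinematic leaf
`Literature.Analysis.FluidPDE.acm_compatible_blocks` (`QuasiSelfSimilarCompatibleBlocks.lean`)
needs the two time-dependent curves `Γ₁` (straight generator `Gen.S`) and `Γ₂` (bent generator
`Gen.B`) of ACM 2019, §8.1, which the source gives **by figures only** (§8.9: "Due to the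
complexity that a rigorous construction would entail, we only give a precise description of the
initial states `Γ₁(0)`, `Γ₂(0)`, and of the final states `Γ₁(1)`, `Γ₂(1)` (see Figure 9) and
sketch some of the intermediate states (Figures 10 and 12)"). The text rendering of the paper
available to the tree carries no figures; this file records, as decidable Lean data, what the
vector figures of the arXiv source (`fig8d-v2.pdf`, `fig8e-v2.pdf`, `fig8f-v2.pdf`,
`fig8g-v2.pdf`, read off their PDF path coordinates and normalised to the unit square) actually
draw, in the conventions of `QuasiSelfSimilarGenerators.lean` (`S` joins the left side to the
right side, `B` the left side to the bottom side of `[0,1]²`; ACM draw `Γ₁` from the bottom side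
to the top side and `Γ₂` from the bottom side to the right side of `[-1/2,1/2]²`, and the data
below are their pictures moved by the corresponding symmetry of the square), together with the
arithmetic identities that make these shapes *forced* rather than chosen (§6 adds the
bookkeeping of the fine stage along the two paths: flank-circulation offsets and sliding
coefficients).

## 1. The initial curves (Fig. 9 = `fig8d`, panels 1 and 3; ACM §8.9)

Both are drawn as rectilinear polygonal lines ("skeletons") whose right-angle corners are
rounded, straight and orthogonal to the side near each gate. The transcriber's reading of the
vector data (provenance in §5 below):

* `Γ₁(0)` (`vertsS0`, skeleton): `(0,½) → (0.10,½) → (0.10,0.95) → (0.30,0.95) → (0.30,½) →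
  (0.70,½) → (0.70,0.05) → (0.90,0.05) → (0.90,½) → (1,½)` — the straight segment with two
  opposite rectangular side-bumps of width `0.2` and height `0.45` (eight corners, invariant
  under the rotation by `π` about the centre). Rectilinear length `14/5` (`rectLength_vertsS0`).
* `Γ₂(0)` (`vertsB0`, skeleton): `(0,½) → (0.70,½) → (0.70,0.95) → (0.90,0.95) → (0.90,0.10) →
  (½,0.10) → (½,0)` — five corners (turning left, right, right, right, left). Rectilinear
  length `27/10` (`rectLength_vertsB0`); the component of `[0,1]²` minus the skeleton containing
  the corner `(0,0)` has area exactly `1/2` (`cornerArea_vertsB0`, shoelace): the drawing is to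
  scale with the equal-area condition (d') (which ACM impose on the rounded curve by tuning
  `h₂`).
* The "small squares of sidelength `1/5`" of ACM §8.9 ("outside these small squares the curves
  consist of segments and half-lines; the intersections … with the small squares are not
  exactly quarters of circle, but smooth curves … these modified quarters of circle agree up to
  reflections, rotations, and translations") are drawn CENTRED AT THE SKELETON CORNERS — eight in
  panel 1, five in panel 3 — so that inside each of them the curve joins the midpoints of two
  adjacent sides of the small square by two straight legs and an arc (cubic Bézier arcs of
  radius `≈ 0.048` as drawn): this is the "modified quarter of circle". Four of the eight small
  squares of panel 1 and two of the five of panel 3 protrude from the unit square by `≈ 0.05`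
  as drawn (the corners at distance `0.05` from a side), which the text does not exclude.
* The construction parameters `h₁`, `h₂` of §8.9 are only labelled in the figure, by double
  arrows: in panel 1 two horizontal arrows spanning `X ∈ [0.15, 0.40]` at `Y = 0.41` and
  `X ∈ [0.60, 0.85]` at `Y = 1.00`, i.e. the straight part of the bar of each hook of `Γ₁(0)`
  between its two corner squares (`h₁ = 0.25` as drawn; in the convention below: the straight
  part of the long sides of the side-bumps); in panel 3 one vertical arrow spanning
  `Y ∈ [0.60, 0.845]` at `X = 0.41`, the straight part of the inner leg of `Γ₂(0)` between its
  two corner squares (`h₂ = 0.25` as drawn; below: the straight part of the leg `x = 0.70`). ACM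
  §8.9: `h₂` is chosen so that `Γ₂(0)` satisfies (d') (`Γ₁(0)` satisfies (d') for every `h₁` by
  symmetry), then `h₁` so that (c') `ℓ₁(0) = ℓ₂(0)` holds (as drawn the two skeletons have
  rectilinear lengths `2.8` and `2.7`; the true lengths are those of the rounded curves).

## 2. Why these shapes are forced (for any discharge of `acm_compatible_blocks` by two generators)

Let a generator system (`acm_compatible_blocks_of_generators`) have channel ("band") area `σ`
in `[0,1]²` at `t = 0` (the same for `S` and `B`, see (b)).
(a) **Equal areas.** Each block is a sealed incompressible cell (`tangent` on all four closed
faces), so the two components of the complement of the band keep their areas during the move.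
For `B` let `β` be the area of the component containing the corner `(0,0)` between its two
gates. At `t = 1` that component meets every one of the `25` subsquares in the part lying on the
right-hand side of the oriented child channel: area `(1-σ)/2 · 1/25` in a straight child
(symmetric `S`), `β/25` in a bent child where the path turns right, `(1-σ-β)/25` where it turns
left. A path entering through the left side and leaving through the bottom side has
`#right - #left = 1`, whence `25 β = n_S (1-σ)/2 + (L+1) β + L (1-σ-β)`, i.e. `β = (1-σ)/2`
(`cornerArea_forced`): the bent channel splits the complement of the band into two EQUAL halves
(ACM (d')), so its centre line must travel from `(0,½)` far towards `(1,1)` before coming back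
to `(½,0)` — at least five corners for a rectilinear line; a plain rounded quarter-turn
(`β ≈ 1/4`) admits NO incompressible move onto any snake (`cornerArea_quarterTurn_ne`).
(b) **Equal lengths.** Transport preserves the distribution function of `Θ`, and
self-similarity at `t = 1` expresses the distribution function of `Θ_g(1,·)` as the average of
those of the children; the child-count matrix is irreducible, so (Perron–Frobenius) `Θ_S(0,·)`
and `Θ_B(0,·)` are equimeasurable. For bands that are graphs of constant vertical width over a
common transversal profile (in the axis frame on straight runs, in the diagonal frame on the
rounded corners) equimeasurability is equality of the axis-extents, i.e. of the RECTILINEAR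
lengths of the two centre lines (ACM (c')); with (a) this makes `Γ₁(0)` a meander of
rectilinear length `≈ 2.7`, not a straight segment.
(c) **Lock-step thinning.** The gate field is universal (`eq_gate`, one `Θg k` for all blocks),
and self-similarity at the outer gates of the middle boundary children forces
`Θg k 1 ζ = Θg k 0 (5 ζ)` near the midpoint: the band is thinned by the factor `5` at every gate
during `[0,1]`, by the SAME time law for `S` and `B` (ACM (c): `ℓ₁(t) = ℓ₂(t)`, obtained from
(c'') by a change of time).
(d) **Margins.** `vanish`/`eq_gate` force the band half-width at a gate to be `< δ` at all
times, while at `t = 1` the legs of the scaled shapes in the boundary cells run at distance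
`0.05/5`–`0.10/5` from `∂[0,1]²`; so `w₀ < δ < 1/100`-ish for the shapes as drawn (moving the
bumps/legs of `Γ₁(0)`, `Γ₂(0)` further inside relaxes this proportionally).

## 3. The coarse snakes at `t = 1/2` (Fig. 10 panel 4, Fig. 12 panel 4; ACM §8.10–8.11)

At `t = 1/2` both curves are Hamiltonian rectilinear paths through the `25` cells of `𝒯_{1/5}`
whose cell pieces are plain straight segments and plain rounded quarter-turns ("within each of
these squares `Γ₁(1/2)` agrees with one of the modified quarters of circle"):
* `Γ₁(1/2)` (`acmPathS`, cells `(column, row)` from the left gate cell `(0,2)` to the right gate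
  cell `(4,2)`): the row-boustrophedon
  `(0,2)(0,3)(0,4)(1,4)(2,4)(3,4)(4,4)(4,3)(3,3)(2,3)(1,3)(1,2)(2,2)(3,2)(3,1)(2,1)(1,1)(0,1)(0,0)
  (1,0)(2,0)(3,0)(4,0)(4,1)(4,2)` — invariant under the rotation by `π`; `13` straight cells, `6`
  left and `6` right turns. This is exactly the `S`-table `peanoChildGen .S`/`peanoChildSym .S`
  of `QuasiSelfSimilarGenerators.lean`.
* `Γ₂(1/2)` (`acmPathB`, from the left gate cell `(0,2)` to the bottom gate cell `(2,0)`):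
  `(0,2)(0,1)(0,0)(1,0)(1,1)(1,2)(1,3)(0,3)(0,4)(1,4)(2,4)(2,3)(2,2)(3,2)(3,3)(3,4)(4,4)(4,3)(4,2)
  (4,1)(4,0)(3,0)(3,1)(2,1)(2,0)` — `10` straight cells, `7` left and `8` right turns
  (`acmTurnsB`); NOT the bent table of `peanoChildGen .B` (an arbitrary admissible example).
  The snake table of both ACM paths is `acmChildGen`/`acmChildSym` (`isSnakeTable_acm`, by
  `decide`; the codes fix the gates of each child, the chirality of the bent children is the one
  the moves of §4 produce and may be adjusted by the gate-preserving reflection).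
* The one asymmetry (ACM §8.11, second step): at `t = 1/2` the FIRST cell `(0,2)` of `Γ₂` (ACM's
  last cell, the middle cell of their right side) already carries the final bent shape `Γ₂(0)/5`
  instead of a plain quarter-turn. Reason (`prebulge_forced`): with plain pieces everywhere the
  corner component would have area `(24 (1-σ)/2 + β_quarter)/25 ≠ (1-σ)/2`; the fine stage (§4)
  repairs right and left turns in pairs, and `#right = #left + 1` leaves one right turn over.

## 4. The moves (Fig. 10 = `fig8e`, Fig. 11 = `fig8f`, Fig. 12 = `fig8g`)

* Coarse `Γ₁` (`[0,1/2]`, symmetric under the rotation by `π`, hence (d') for free): the tips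
  of the two side-bumps sprout perpendicular legs (panel 2: arrows), the legs lengthen and
  translate outward (panel 3) until the curve is the boustrophedon of §3 (panel 4).
* Coarse `Γ₂` (`[0,1/4]`: the long run `y = ½` sprouts a down–up meander, two new legs, drawn
  symmetric; `[1/4,1/2]`: the top corner region shifts, the bottom leg grows, and the cell at
  the exit gate is pre-bulged by fine move 2 "suitably synchronized" with the rest so that (d')
  holds at all times).
* Fine stage (`[1/2,1]`, ACM Fig. 11): in every cell independently, at scale `1/5`,
  move 1 (straight piece ↦ `Γ₁(0)`: the two opposite side-bumps grow out of the segment;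
  area-neutral by symmetry) or move 2 (plain quarter-turn ↦ `Γ₂(0)`: first the leg is translated
  sideways to `0.10` from the wall, producing the dog-leg at the gate, then the far corner grows
  the bump up to `0.95`; each sub-step changes the in-cell area split, and the moves are run in
  (right turn, left turn) pairs so that the two changes cancel — the displaced fluid travels
  between the paired cells across the interior cell interfaces, which are not walls).
During the whole evolution the length `ℓ(t)` increases ((c'')), the tube radius is `r/ℓ(t)`,
and near every gate the field is the canonical field of the straight line (hyperbolic
thinning), ACM §8.4 (c), Lemma 25.

## 5. Provenance of the figure data

arXiv:1605.02090v4 ships the figures as vector PDF files (`fig8d-v2.pdf` etc., produced by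
xfig/fig2dev). Inflating the content stream of `fig8d-v2.pdf` (zlib) gives the path operators
(`m`, `l`, `c`, `re`) in user units scaled by `0.1 pt` (`0.1 0 0 0.1 0 0 cm`). Panel 1
(`Γ₁(0)`): frame square `re` at `(215.21, 226.71)`, side `567.6`; the curve (line width `4.5`)
consists of the segments `x = 498.3` (`X = 0.499`) for `y ∈ [224.6, 257.9] ∪ [423.8, 598.7] ∪
[763.4, 886.7]`, `y = 284.5` (`Y = 0.102`) and `y = 397.3` (`Y = 0.300`) for
`x ∈ [269.2, 472.9]`, `x = 243.9` (`X = 0.050`) for `y ∈ [309.8, 371.9]`, `y = 624.1`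
(`Y = 0.700`) and `y = 738.1` (`Y = 0.901`) for `x ∈ [524.8, 727.3]`, `x = 753.9` (`X = 0.949`)
for `y ∈ [650.6, 711.5]`, joined by cubic Bézier arcs spanning `27–29` units in each direction
(radius `≈ 0.048–0.051`); the eight grey squares (line width `1.99`) have lower-left corners
`(187.61, 226.71)`, `(187.61, 340.71)`, `(442.01, 226.71)`, `(442.01, 340.71)`,
`(442.01, 567.51)`, `(442.01, 680.31)`, `(697.61, 567.51)`, `(697.61, 680.31)` and sides
`112.8–114.0` (`= 1/5`), i.e. they are centred at the skeleton corners
`(0.05, 0.10), (0.05, 0.30), (0.50, 0.10), (0.50, 0.30), (0.50, 0.70), (0.50, 0.90),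
(0.95, 0.70), (0.95, 0.90)` (normalised coordinates `X = (x - 215.21)/567.6`,
`Y = (y - 226.71)/567.6`, ACM's orientation: gates at the bottom and top midpoints). Panel 3
(`Γ₂(0)`): frame at `(1774.01, 226.71)`; segments `x = 2058.3` (`X = 0.501`, the stem through
the bottom gate, `y ∈ [153.8, 257.9]`), `y = 284.5` (`Y = 0.102`, `x ∈ [1856.8, 2031.7]`),
`x = 1831.5` (`X = 0.101`, `y ∈ [309.8, 740.3]`), `y = 765.7` (`Y = 0.950`,
`x ∈ [1856.8, 1918.9]`), `x = 1944.3` (`X = 0.300`, `y ∈ [536.6, 740.3]`), `y = 511.3`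
(`Y = 0.501`, `x ∈ [1970.8, 2380.9]`, through the right gate); five grey squares centred at
`(0.10, 0.94), (0.30, 0.94), (0.10, 0.10), (0.50, 0.10), (0.30, 0.50)`. The data of this file
are these readings moved to the conventions of `QuasiSelfSimilarGenerators.lean` (`Γ₁`: rotate
by `-π/2`; `Γ₂`: reflect `X ↦ 1 - X` and reverse the orientation) and rounded to the grid
`1/20`. The coarse paths of §3 are read off panels 4 of `fig8e-v2.pdf` and `fig8g-v2.pdf` in
the same way (the `25` grey cells of `𝒯_{1/5}` are drawn there); the double arrows are the thin
(`0.99`) lines `(0.150, 0.406)–(0.400, 0.406)`, `(0.601, 1.003)–(0.847, 1.003)` of panel 1 and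
`(0.406, 0.600)–(0.406, 0.845)` of panel 3 (normalised).

## References

* G. Alberti, G. Crippa, A. L. Mazzucato, *Exponential self-similar mixing by incompressible
  flows*, J. Amer. Math. Soc. 32 (2019), 445–490, §8.1–8.3, §8.9–8.11, Figs. 9–12
  (arXiv:1605.02090v4: source files `fig8d-v2.pdf`, `fig8e-v2.pdf`, `fig8f-v2.pdf`,
  `fig8g-v2.pdf`).
* E. Bruè, C. De Lellis, *Anomalous dissipation for the forced 3D Navier–Stokes equations*,
  Comm. Math. Phys. 400 (2023), 1507–1533, §4.1.
-/

namespace Literature.Analysis.FluidPDE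

namespace QuasiSelfSimilar

namespace ACMFigures

/-! ## 1. The initial curves as rectilinear vertex lists -/

/-- The skeleton (rectilinear vertex list) of ACM's `Γ₁(0)` as drawn in Fig. 9, panel 1
(transcriber's reading of the vector figure, §5 of the file docstring), moved to the convention
"left side to right side" and rounded to the grid `1/20`. [cite: AlbertiCrippaMazzucato2019, §8.9, Fig. 9] -/
def vertsS0 : List (ℚ × ℚ) :=
  [(0, 1/2), (1/10, 1/2), (1/10, 19/20), (3/10, 19/20), (3/10, 1/2), (7/10, 1/2),
   (7/10, 1/20), (9/10, 1/20), (9/10, 1/2), (1, 1/2)]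

/-- The skeleton of ACM's `Γ₂(0)` as drawn in Fig. 9, panel 3 (transcriber's reading, §5 of the
file docstring), moved to the convention "left side to bottom side". [cite: AlbertiCrippaMazzucato2019, §8.9, Fig. 9] -/
def vertsB0 : List (ℚ × ℚ) :=
  [(0, 1/2), (7/10, 1/2), (7/10, 19/20), (9/10, 19/20), (9/10, 1/10), (1/2, 1/10), (1/2, 0)]

/-- Rectilinear (`ℓ¹`) length of a polygonal line. [folklore] -/
def rectLength : List (ℚ × ℚ) → ℚ
  | [] => 0
  | [_] => 0
  | p :: q :: l => |q.1 - p.1| + |q.2 - p.2| + rectLength (q :: l)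

/-- Twice the signed (shoelace) area of the polygon closing up a vertex list. [folklore] -/
def shoelace2Aux (p₀ : ℚ × ℚ) : List (ℚ × ℚ) → ℚ
  | [] => 0
  | [p] => p.1 * p₀.2 - p₀.1 * p.2
  | p :: q :: l => (p.1 * q.2 - q.1 * p.2) + shoelace2Aux p₀ (q :: l)

/-- The (unsigned) shoelace area of the closed polygon through a vertex list. [folklore] -/
def shoelaceArea (l : List (ℚ × ℚ)) : ℚ :=
  match l with
  | [] => 0
  | p₀ :: _ => |shoelace2Aux p₀ l| / 2

/-- The skeleton of `Γ₁(0)` as drawn has rectilinear length `2.8` (transcriber's reading). [cite: AlbertiCrippaMazzucato2019, Fig. 9] -/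
theorem rectLength_vertsS0 : rectLength vertsS0 = 14 / 5 := by
  simp only [rectLength, vertsS0]; norm_num

/-- The skeleton of `Γ₂(0)` as drawn has rectilinear length `2.7` (transcriber's reading; ACM
tune `h₁` so that the true lengths of the rounded curves agree, condition (c')). [cite: AlbertiCrippaMazzucato2019, Fig. 9] -/
theorem rectLength_vertsB0 : rectLength vertsB0 = 27 / 10 := by
  simp only [rectLength, vertsB0]; norm_num

/-- `Γ₁(0)` is invariant under the rotation by `π` about the centre of the square (so it splits
the square into two halves of equal area, ACM (d') "for symmetry reasons"). [cite: AlbertiCrippaMazzucato2019, §8.9] -/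
theorem vertsS0_centrallySymmetric :
    vertsS0.reverse = vertsS0.map (fun p => (1 - p.1, 1 - p.2)) := by
  simp only [vertsS0, List.reverse_cons, List.map]; norm_num

/-- **The drawing is to scale with ACM's equal-area condition (d')**: the component of the
complement of the SKELETON of `Γ₂(0)` containing the corner `(0,0)` (the polygon closed up
through `(0,0)`) has area exactly `1/2` (transcriber's reading; ACM impose (d') on the rounded
curve by the choice of `h₂`, §8.9). [cite: AlbertiCrippaMazzucato2019, §8.3 (d'), §8.9] -/
theorem cornerArea_vertsB0 : shoelaceArea (vertsB0 ++ [((0 : ℚ), (0 : ℚ))]) = 1 / 2 := by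
  simp only [shoelaceArea, shoelace2Aux, vertsB0, List.cons_append, List.nil_append]
  norm_num

/-! ## 2. The forced identities -/

/-- **The corner area of the bent generator is forced** (§2 (a) of the file docstring): if the
straight children contribute `(1-σ)/2`, right turns `β` and left turns `1-σ-β` (per unit cell),
a bent path with `nS` straight cells, `L` left turns and `L + 1` right turns and `25` cells in
all conserves the corner area only if `β = (1-σ)/2`. [folklore] -/
theorem cornerArea_forced {σ β : ℝ} {nS L : ℕ} (hcells : nS + L + (L + 1) = 25)
    (harea : 25 * β = nS * ((1 - σ) / 2) + (L + 1) * β + L * (1 - σ - β)) :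
    β = (1 - σ) / 2 := by
  have h25 : (nS : ℝ) + L + (L + 1) = 25 := by exact_mod_cast hcells
  linear_combination (harea + ((1 - σ) / 2) * h25) / 24

/-- In particular a plain rounded quarter-turn (corner area `< (1-σ)/2`, e.g. `≈ 1/4`) is not an
admissible bent generator: no incompressible sealed move takes it onto a snake of copies of
itself and of a symmetric straight generator. [folklore] -/
theorem cornerArea_quarterTurn_ne {σ β : ℝ} {nS L : ℕ} (hcells : nS + L + (L + 1) = 25)
    (hβ : β < (1 - σ) / 2) :
    25 * β ≠ nS * ((1 - σ) / 2) + (L + 1) * β + L * (1 - σ - β) := fun h =>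
  absurd (cornerArea_forced hcells h) (ne_of_lt hβ)

/-- **The pre-bulged cell is forced** (§3 of the file docstring; ACM §8.11, second step): if at
an intermediate time the bent curve is a snake of plain pieces — straight cells contributing
`(1-σ)/2`, plain quarter-turns contributing `q` (right) and `1-σ-q` (left) — except for `m`
right-turn cells already carrying the final shape (contributing `(1-σ)/2`), then conservation of
the corner area `(1-σ)/2` forces `(L + 1 - m) q = (L + 1 - m) (1-σ)/2`; so with `q ≠ (1-σ)/2`
exactly `m = L + 1 - L = 1` net right turn must be pre-bulged when the others are repaired in
right/left pairs. Here the bookkeeping identity. [folklore] -/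
theorem prebulge_forced {σ q : ℝ} {nS L m : ℕ} (hm : m ≤ L + 1) (hcells : nS + L + (L + 1) = 25)
    (harea : 25 * ((1 - σ) / 2) =
      nS * ((1 - σ) / 2) + m * ((1 - σ) / 2) + (L + 1 - m : ℕ) * q + L * (1 - σ - q)) :
    ((L + 1 - m : ℕ) : ℝ) * q = ((L + 1 - m : ℕ) - L : ℝ) * ((1 - σ) / 2) + L * q := by
  have h25 : (nS : ℝ) + L + (L + 1) = 25 := by exact_mod_cast hcells
  have hsub : ((L + 1 - m : ℕ) : ℝ) = L + 1 - m := by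
    rw [Nat.cast_sub hm]; push_cast; ring
  rw [hsub] at harea ⊢
  linear_combination (-1 : ℝ) * harea - ((1 - σ) / 2) * h25

/-! ## 3. The coarse paths and their snake table -/

/-- ACM's coarse path of `Γ₁(1/2)` (Fig. 10, panel 4), cells `(column, row)` in the order
visited from the left gate cell `(0,2)` to the right gate cell `(4,2)`. [cite: AlbertiCrippaMazzucato2019, §8.10, Fig. 10] -/
def acmPathS : Fin 25 → Fin 5 × Fin 5 :=
  ![(0,2), (0,3), (0,4), (1,4), (2,4), (3,4), (4,4), (4,3), (3,3), (2,3), (1,3), (1,2), (2,2),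
    (3,2), (3,1), (2,1), (1,1), (0,1), (0,0), (1,0), (2,0), (3,0), (4,0), (4,1), (4,2)]

/-- ACM's coarse path of `Γ₂(1/2)` (Fig. 12, panel 4), cells `(column, row)` in the order
visited from the left gate cell `(0,2)` to the bottom gate cell `(2,0)`. [cite: AlbertiCrippaMazzucato2019, §8.11, Fig. 12] -/
def acmPathB : Fin 25 → Fin 5 × Fin 5 :=
  ![(0,2), (0,1), (0,0), (1,0), (1,1), (1,2), (1,3), (0,3), (0,4), (1,4), (2,4), (2,3), (2,2),
    (3,2), (3,3), (3,4), (4,4), (4,3), (4,2), (4,1), (4,0), (3,0), (3,1), (2,1), (2,0)]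

/-- Two cells are adjacent (share a side). [folklore] -/
def Adjacent (p q : Fin 5 × Fin 5) : Prop :=
  ((p.1 : ℕ) = q.1 ∧ ((p.2 : ℕ) + 1 = q.2 ∨ (q.2 : ℕ) + 1 = p.2)) ∨
    ((p.2 : ℕ) = q.2 ∧ ((p.1 : ℕ) + 1 = q.1 ∨ (q.1 : ℕ) + 1 = p.1))

/-- Adjacency is decidable. [folklore] -/
instance (p q : Fin 5 × Fin 5) : Decidable (Adjacent p q) := by
  unfold Adjacent; infer_instance

/-- `Γ₁(1/2)` is a Hamiltonian path of the `5 × 5` grid from `(0,2)` to `(4,2)`. [cite: AlbertiCrippaMazzucato2019, Fig. 10] -/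
theorem acmPathS_hamiltonian :
    Function.Injective acmPathS ∧ (∀ i : Fin 24, Adjacent (acmPathS i.castSucc) (acmPathS i.succ)) ∧
      acmPathS 0 = (0, 2) ∧ acmPathS (Fin.last 24) = (4, 2) := by
  refine ⟨?_, by decide, by decide, by decide⟩
  intro a b; revert a b; decide

/-- `Γ₂(1/2)` is a Hamiltonian path of the `5 × 5` grid from `(0,2)` to `(2,0)`. [cite: AlbertiCrippaMazzucato2019, Fig. 12] -/
theorem acmPathB_hamiltonian :
    Function.Injective acmPathB ∧ (∀ i : Fin 24, Adjacent (acmPathB i.castSucc) (acmPathB i.succ)) ∧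
      acmPathB 0 = (0, 2) ∧ acmPathB (Fin.last 24) = (2, 0) := by
  refine ⟨?_, by decide, by decide, by decide⟩
  intro a b; revert a b; decide

/-- `Γ₁(1/2)` is invariant under the rotation by `π` about the centre (cell `(i,j) ↦ (4-i,4-j)`,
order reversed) — the symmetry that gives (d') during the coarse stage of `Γ₁`. [cite: AlbertiCrippaMazzucato2019, §8.10] -/
theorem acmPathS_centrallySymmetric :
    ∀ i : Fin 25, acmPathS (Fin.rev i) = (Fin.rev (acmPathS i).1, Fin.rev (acmPathS i).2) := by
  decide

/-- The kind of a cell of an oriented grid path: straight, left turn, right turn. [folklore] -/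
inductive Turn
  | S | L | R
  deriving DecidableEq, Repr

/-- The turn sequence of `Γ₁(1/2)` along `acmPathS` (entering `(0,2)` eastward, leaving `(4,2)`
eastward): `13` straight cells, `6` left and `6` right turns. [cite: AlbertiCrippaMazzucato2019, Fig. 10] -/
def acmTurnsS : Fin 25 → Turn :=
  ![.L, .S, .R, .S, .S, .S, .R, .R, .S, .S, .L, .L, .S, .R, .R, .S, .S, .L, .L, .S, .S, .S, .L,
    .S, .R]

/-- The turn sequence of `Γ₂(1/2)` along `acmPathB` (entering `(0,2)` eastward, leaving `(2,0)`
southward): `10` straight cells, `7` left and `8` right turns; the first cell (a right turn at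
the entrance gate) is the pre-bulged one. [cite: AlbertiCrippaMazzucato2019, Fig. 12] -/
def acmTurnsB : Fin 25 → Turn :=
  ![.R, .S, .L, .L, .S, .S, .L, .R, .R, .S, .R, .S, .L, .L, .S, .R, .R, .S, .S, .S, .R, .R, .L,
    .L, .S]

/-- The heading after a cell, from the heading before it (`0,1,2,3` = E, N, W, S) and the turn.
[folklore] -/
def Turn.apply : Turn → Fin 4 → Fin 4
  | .S, d => d
  | .L, d => d + 1
  | .R, d => d - 1

/-- The displacement of a heading. [folklore] -/
def headingStep : Fin 4 → ℤ × ℤ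
  | 0 => (1, 0)
  | 1 => (0, 1)
  | 2 => (-1, 0)
  | 3 => (0, -1)

/-- Consistency of a turn sequence with a cell path entered eastward: the heading after cell
`i` points from cell `i` to cell `i+1`. [folklore] -/
def TurnsConsistent (path : Fin 25 → Fin 5 × Fin 5) (turns : Fin 25 → Turn) : Prop :=
  ∀ i : Fin 24,
    let d := (List.ofFn fun j : Fin 25 => turns j).take (i + 1) |>.foldl (fun d τ => τ.apply d) 0
    (((path i.succ).1 : ℤ) - (path i.castSucc).1, ((path i.succ).2 : ℤ) - (path i.castSucc).2) =
      headingStep d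

/-- Consistency of a turn sequence is decidable. [folklore] -/
instance (path : Fin 25 → Fin 5 × Fin 5) (turns : Fin 25 → Turn) :
    Decidable (TurnsConsistent path turns) := by
  unfold TurnsConsistent; infer_instance

/-- The turn sequences are those of the paths; the final headings are east (`Γ₁` leaves through
the right side) and south (`Γ₂` leaves through the bottom side). [folklore] -/
theorem acmTurns_consistent :
    TurnsConsistent acmPathS acmTurnsS ∧ TurnsConsistent acmPathB acmTurnsB ∧
      (List.ofFn acmTurnsS).foldl (fun d τ => τ.apply d) 0 = 0 ∧
      (List.ofFn acmTurnsB).foldl (fun d τ => τ.apply d) 0 = 3 := by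
  decide

/-- Turn counts: `(13, 6, 6)` for `Γ₁(1/2)` and `(10, 7, 8)` for `Γ₂(1/2)`. [folklore] -/
theorem acmTurns_count :
    (List.ofFn acmTurnsS).count .S = 13 ∧ (List.ofFn acmTurnsS).count .L = 6 ∧
      (List.ofFn acmTurnsS).count .R = 6 ∧ (List.ofFn acmTurnsB).count .S = 10 ∧
      (List.ofFn acmTurnsB).count .L = 7 ∧ (List.ofFn acmTurnsB).count .R = 8 := by
  decide

/-- **ACM's snake table, child types**: the generator placed in the subsquare `(p 0, p 1)`
(column, row) of `S` (= the table `peanoChildGen .S` of `QuasiSelfSimilarGenerators.lean`,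
which is ACM's Fig. 10) and of `B` (ACM's Fig. 12, NOT `peanoChildGen .B`). [cite: AlbertiCrippaMazzucato2019, Figs. 10, 12] -/
def acmChildGen (g : Gen) (p : Fin 2 → Fin 5) : Gen :=
  match g, (p 0 : ℕ), (p 1 : ℕ) with
  | .S, _, _ => peanoChildGen .S p
  | .B, 0, 0 => .B
  | .B, 0, 1 => .S
  | .B, 0, 2 => .B
  | .B, 0, 3 => .B
  | .B, 0, 4 => .B
  | .B, 1, 0 => .B
  | .B, 1, 1 => .S
  | .B, 1, 2 => .S
  | .B, 1, 3 => .B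
  | .B, 1, 4 => .S
  | .B, 2, 0 => .S
  | .B, 2, 1 => .B
  | .B, 2, 2 => .B
  | .B, 2, 3 => .S
  | .B, 2, 4 => .B
  | .B, 3, 0 => .B
  | .B, 3, 1 => .B
  | .B, 3, 2 => .B
  | .B, 3, 3 => .S
  | .B, 3, 4 => .B
  | .B, 4, 0 => .B
  | .B, 4, 1 => .S
  | .B, 4, 2 => .S
  | .B, 4, 3 => .S
  | .B, 4, 4 => .B
  | _, _, _ => .S

/-- **ACM's snake table, child positions** (codes fixing the gates of each child: straight
children traversed vertically are swapped, bent children are flipped along the axis `k` iff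
their gate on that axis is the upper face). [cite: AlbertiCrippaMazzucato2019, Figs. 10, 12] -/
def acmChildSym (g : Gen) (p : Fin 2 → Fin 5) : SymmCode :=
  match g, (p 0 : ℕ), (p 1 : ℕ) with
  | .S, _, _ => peanoChildSym .S p
  | .B, 0, 0 => ⟨false, ![true, true]⟩
  | .B, 0, 1 => ⟨true, ![false, false]⟩
  | .B, 0, 2 => ⟨false, ![false, false]⟩
  | .B, 0, 3 => ⟨false, ![true, true]⟩
  | .B, 0, 4 => ⟨false, ![true, false]⟩
  | .B, 1, 0 => ⟨false, ![false, true]⟩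
  | .B, 1, 1 => ⟨true, ![false, false]⟩
  | .B, 1, 2 => ⟨true, ![false, false]⟩
  | .B, 1, 3 => ⟨false, ![false, false]⟩
  | .B, 1, 4 => ⟨false, ![false, false]⟩
  | .B, 2, 0 => ⟨true, ![false, false]⟩
  | .B, 2, 1 => ⟨false, ![true, false]⟩
  | .B, 2, 2 => ⟨false, ![true, true]⟩
  | .B, 2, 3 => ⟨true, ![false, false]⟩
  | .B, 2, 4 => ⟨false, ![false, false]⟩
  | .B, 3, 0 => ⟨false, ![true, true]⟩
  | .B, 3, 1 => ⟨false, ![false, false]⟩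
  | .B, 3, 2 => ⟨false, ![false, true]⟩
  | .B, 3, 3 => ⟨true, ![false, false]⟩
  | .B, 3, 4 => ⟨false, ![true, false]⟩
  | .B, 4, 0 => ⟨false, ![false, true]⟩
  | .B, 4, 1 => ⟨true, ![false, false]⟩
  | .B, 4, 2 => ⟨true, ![false, false]⟩
  | .B, 4, 3 => ⟨true, ![false, false]⟩
  | .B, 4, 4 => ⟨false, ![false, false]⟩
  | _, _, _ => ⟨false, ![false, false]⟩

set_option maxRecDepth 4000 in
/-- **ACM's table is a snake table**: adjacent children match and boundary children carry the
parent's gates exactly at the middle of the crossed sides (by `decide`); so it can be fed to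
`acm_compatible_blocks_of_generators` / `acm_compatible_blocks_of_generator_moves`. [cite: AlbertiCrippaMazzucato2019, §8.1 (e)] -/
theorem isSnakeTable_acm : IsSnakeTable acmChildGen acmChildSym :=
  ⟨by decide, by decide, by decide⟩

/-- The table lists the cells of the two paths: the child in cell `acmPathS i` of `S` is bent iff
the path turns there, and likewise for `B`. [folklore] -/
theorem acmChildGen_path :
    (∀ i, acmChildGen .S (fun k => if k = 0 then (acmPathS i).1 else (acmPathS i).2) =
        (if acmTurnsS i = .S then Gen.S else Gen.B)) ∧
      ∀ i, acmChildGen .B (fun k => if k = 0 then (acmPathB i).1 else (acmPathB i).2) =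
        (if acmTurnsB i = .S then Gen.S else Gen.B) := by
  constructor <;> decide

/-- The straight generator `S` has at least one bent child in ACM's table (the hypothesis `hbent`
of `acm_compatible_blocks_of_generator_moves`: the bent generator's `t = 0` moments then follow
from the straight one's by conservation and the cell decomposition at `t = 1`). [folklore] -/
theorem exists_acmChildGen_straight_eq_bent : ∃ p : Fin 2 → Fin 5, acmChildGen .S p = .B :=
  ⟨![0, 0], by decide⟩

/-! ## 6. Fine-stage bookkeeping along the two paths (ACM §8.10–8.11: the fine moves "coupled"
and "suitably synchronized") -/

/-- The sign of a turn for the area bookkeeping of the fine stage: in a right-turn cell the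
corner side of the bent child is the right-hand side of the parent channel (its fine move adds
area to it), in a left-turn cell it is the left-hand side (its fine move removes area from the
right-hand side); straight cells are neutral (the fine move of the straight generator is
symmetric). [folklore] -/
def Turn.sign : Turn → ℤ
  | .S => 0
  | .R => 1
  | .L => -1

/-- **Flank-circulation offsets of the fine stage of `S`**: the stream offset (in units of the
common area rate `ȧ(t)` of the fine moves) carried across the interior gate after the `i`-th cell
of `acmPathS` when all `25` fine moves run simultaneously — the partial sums of the turn signs.
[folklore] -/
def offsetS (i : Fin 25) : ℤ := ((List.ofFn acmTurnsS).take (i + 1)).map Turn.sign |>.sum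

/-- **Flank-circulation offsets of the fine stage of `B`**: the same along `acmPathB`, the
pre-bulged entrance cell (`i = 0`, already final at `t = 1/2`) being inert. [folklore] -/
def offsetB (i : Fin 25) : ℤ := (((List.ofFn acmTurnsB).take (i + 1)).drop 1).map Turn.sign |>.sum

/-- **The fine stage of `S` is area-balanced with bounded offsets**: the offsets return to `0`
at the exit gate (six right and six left turns) and stay in `[-1, 2]`; so the outer gates carry no
circulation (sealed cell) and at most two units of flank flux cross any interior interface.
[cite: AlbertiCrippaMazzucato2019, §8.10] -/
theorem offsetS_balanced : offsetS (Fin.last 24) = 0 ∧ ∀ i, -1 ≤ offsetS i ∧ offsetS i ≤ 2 := by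
  constructor <;> decide

/-- **The fine stage of `B` is area-balanced once the entrance cell is pre-bulged**: excluding
the inert cell `0`, seven right and seven left turns; the offsets return to `0` and stay in
`[-3, 2]`. [cite: AlbertiCrippaMazzucato2019, §8.11] -/
theorem offsetB_balanced : offsetB (Fin.last 24) = 0 ∧ ∀ i, -3 ≤ offsetB i ∧ offsetB i ≤ 2 := by
  constructor <;> decide

/-- Turn counts behind the balance: `S` has `6 + 6` turns; `B` has `8 + 7`, i.e. `7 + 7` besides
the pre-bulged right turn at the entrance. [folklore] -/
theorem fineStage_pairs :
    ((List.ofFn acmTurnsS).map Turn.sign).sum = 0 ∧ ((List.ofFn acmTurnsB).map Turn.sign).sum = 1 ∧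
      acmTurnsB 0 = .R ∧ (((List.ofFn acmTurnsB).drop 1).map Turn.sign).sum = 0 := by
  decide

/-- **Sliding coefficients of the fine stage of `B`**: with the entrance cell inert (fixed shape,
hence fixed channel length while the common width decreases), the other `24` cells lengthen in
lock-step and the channel material slides towards the exit; the material flux through the
interior gate after the `i`-th cell is `(24 - i) φ(t)` for one common rate `φ` (the rate of
change of the channel area of a lengthening cell), vanishing at the exit gate. For `S` (no inert
cell) there is no sliding at all. [folklore] -/
def slideCoeffB (i : Fin 25) : ℕ := 24 - (i : ℕ)

/-- The sliding coefficients decrease by one across every lengthening cell and vanish at the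
exit. [folklore] -/
theorem slideCoeffB_step : slideCoeffB (Fin.last 24) = 0 ∧ slideCoeffB 0 = 24 ∧
    ∀ i : Fin 24, slideCoeffB i.castSucc = slideCoeffB i.succ + 1 := by
  refine ⟨rfl, rfl, fun i => ?_⟩
  simp only [slideCoeffB, Fin.val_castSucc, Fin.val_succ]
  have := i.isLt
  omega

/-! ## 7. The `B`-path `P*` of the explicit coarse move (session-18 design)

The coarse move of the bent channel recorded in `QuasiSelfSimilarDesigns.lean`
(`coarseB_P0 … coarseB_P2`) does not follow ACM's `Γ₂(1/2)` (`acmPathB`, Fig. 12) but the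
Hamiltonian path `pstarPath` below, chosen so that the unpaired right-turn cell is `(4,4)`, the
cell of `B(0)`'s own corner `C0` (static during the whole move). The snake table
`pstarChildGen`/`pstarChildSym` (the `S`-part is again ACM's `Γ₁(1/2)` = `peanoChildGen .S`) is a
snake table (`isSnakeTable_pstar`), and the fine-stage offsets along `P*` with the inert cell
`(4,4)` (index `6`) are balanced (`offsetPstar_balanced`). [folklore]
-/

/-- **The `B`-path `P*`** from the left-gate cell `(0,2)` to the bottom-gate cell `(2,0)`.
[folklore] -/
def pstarPath : Fin 25 → Fin 5 × Fin 5 :=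
  ![(0,2), (0,3), (0,4), (1,4), (2,4), (3,4), (4,4), (4,3), (3,3), (2,3), (1,3), (1,2), (2,2), (3,2), (4,2), (4,1), (4,0), (3,0), (3,1), (2,1), (1,1), (0,1), (0,0), (1,0), (2,0)]

/-- `P*` is a Hamiltonian path of the `5 × 5` grid from `(0,2)` to `(2,0)`. [folklore] -/
theorem pstarPath_hamiltonian :
    Function.Injective pstarPath ∧ (∀ i : Fin 24, Adjacent (pstarPath i.castSucc) (pstarPath i.succ)) ∧
      pstarPath 0 = (0, 2) ∧ pstarPath (Fin.last 24) = (2, 0) := by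
  refine ⟨?_, by decide, by decide, by decide⟩
  intro a b; revert a b; decide

/-- The turn sequence along `P*` (entering `(0,2)` eastward, leaving `(2,0)` southward):
`12` straight cells, `6` left and `7` right turns; the right turn at `(4,4)` (index `6`) is the
pre-bulged one. [folklore] -/
def pstarTurns : Fin 25 → Turn :=
  ![.L, .S, .R, .S, .S, .S, .R, .R, .S, .S, .L, .L, .S, .S, .R, .S, .R, .R, .L, .S, .S, .L, .L, .S, .R]

/-- The turn sequence is that of the path and the final heading is south. [folklore] -/
theorem pstarTurns_consistent :
    TurnsConsistent pstarPath pstarTurns ∧ (List.ofFn pstarTurns).foldl (fun d τ => τ.apply d) 0 = 3 := by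
  decide

/-- Turn counts of `P*`: `(12, 6, 7)`; the inert cell is a right turn. [folklore] -/
theorem pstarTurns_count :
    (List.ofFn pstarTurns).count .S = 12 ∧ (List.ofFn pstarTurns).count .L = 6 ∧
      (List.ofFn pstarTurns).count .R = 7 ∧ pstarTurns ⟨6, by norm_num⟩ = .R ∧
      pstarPath ⟨6, by norm_num⟩ = (4, 4) := by
  decide

/-- **The snake table of the explicit design, child types**: `S`-part = ACM's `Γ₁(1/2)`
(`peanoChildGen .S`), `B`-part = the cells of `P*` (bent iff the path turns there). [folklore] -/
def pstarChildGen (g : Gen) (p : Fin 2 → Fin 5) : Gen :=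
  match g, (p 0 : ℕ), (p 1 : ℕ) with
  | .S, _, _ => peanoChildGen .S p
  | .B, 0, 0 => .B
  | .B, 0, 1 => .B
  | .B, 0, 2 => .B
  | .B, 0, 3 => .S
  | .B, 0, 4 => .B
  | .B, 1, 0 => .S
  | .B, 1, 1 => .S
  | .B, 1, 2 => .B
  | .B, 1, 3 => .B
  | .B, 1, 4 => .S
  | .B, 2, 0 => .B
  | .B, 2, 1 => .S
  | .B, 2, 2 => .S
  | .B, 2, 3 => .S
  | .B, 2, 4 => .S
  | .B, 3, 0 => .B
  | .B, 3, 1 => .B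
  | .B, 3, 2 => .S
  | .B, 3, 3 => .S
  | .B, 3, 4 => .S
  | .B, 4, 0 => .B
  | .B, 4, 1 => .S
  | .B, 4, 2 => .B
  | .B, 4, 3 => .B
  | .B, 4, 4 => .B
  | _, _, _ => .S

/-- **The snake table of the explicit design, child positions** (same coding as `acmChildSym`:
straight children traversed vertically are swapped, bent children are flipped along the axis `k`
iff their gate on that axis is the upper face). [folklore] -/
def pstarChildSym (g : Gen) (p : Fin 2 → Fin 5) : SymmCode :=
  match g, (p 0 : ℕ), (p 1 : ℕ) with
  | .S, _, _ => peanoChildSym .S p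
  | .B, 0, 0 => ⟨false, ![true, true]⟩
  | .B, 0, 1 => ⟨false, ![true, false]⟩
  | .B, 0, 2 => ⟨false, ![false, true]⟩
  | .B, 0, 3 => ⟨true, ![false, false]⟩
  | .B, 0, 4 => ⟨false, ![true, false]⟩
  | .B, 1, 0 => ⟨false, ![false, false]⟩
  | .B, 1, 1 => ⟨false, ![false, false]⟩
  | .B, 1, 2 => ⟨false, ![true, true]⟩
  | .B, 1, 3 => ⟨false, ![true, false]⟩
  | .B, 1, 4 => ⟨false, ![false, false]⟩
  | .B, 2, 0 => ⟨false, ![false, false]⟩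
  | .B, 2, 1 => ⟨false, ![false, false]⟩
  | .B, 2, 2 => ⟨false, ![false, false]⟩
  | .B, 2, 3 => ⟨false, ![false, false]⟩
  | .B, 2, 4 => ⟨false, ![false, false]⟩
  | .B, 3, 0 => ⟨false, ![true, true]⟩
  | .B, 3, 1 => ⟨false, ![false, false]⟩
  | .B, 3, 2 => ⟨false, ![false, false]⟩
  | .B, 3, 3 => ⟨false, ![false, false]⟩
  | .B, 3, 4 => ⟨false, ![false, false]⟩
  | .B, 4, 0 => ⟨false, ![false, true]⟩
  | .B, 4, 1 => ⟨true, ![false, false]⟩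
  | .B, 4, 2 => ⟨false, ![false, false]⟩
  | .B, 4, 3 => ⟨false, ![false, true]⟩
  | .B, 4, 4 => ⟨false, ![false, false]⟩
  | _, _, _ => ⟨false, ![false, false]⟩

set_option maxRecDepth 4000 in
/-- **The table of the explicit design is a snake table** (by `decide`); it can be fed to
`acm_compatible_blocks_of_generators` / `acm_compatible_blocks_of_generator_moves`. [folklore] -/
theorem isSnakeTable_pstar : IsSnakeTable pstarChildGen pstarChildSym :=
  ⟨by decide, by decide, by decide⟩

/-- The table lists the cells of `P*`: the child in cell `pstarPath i` of `B` is bent iff the path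
turns there. [folklore] -/
theorem pstarChildGen_path :
    ∀ i, pstarChildGen .B (fun k => if k = 0 then (pstarPath i).1 else (pstarPath i).2) =
      (if pstarTurns i = .S then Gen.S else Gen.B) := by
  decide

/-- `S` has a bent child in the explicit table too (needed by
`acm_compatible_blocks_of_generator_moves`). [folklore] -/
theorem exists_pstarChildGen_straight_eq_bent : ∃ p : Fin 2 → Fin 5, pstarChildGen .S p = .B :=
  ⟨![0, 2], by decide⟩

/-- **Flank-circulation offsets of the fine stage of `B` along `P*`**: partial sums of the turn
signs, the pre-bulged cell `(4,4)` (index `6`, already final at `t = 1/2`) being inert. [folklore] -/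
def offsetPstar (i : Fin 25) : ℤ :=
  (((List.ofFn pstarTurns).take (i + 1)).zipIdx.filter (fun q => q.2 ≠ 6)).map (fun q => q.1.sign) |>.sum

/-- **The fine stage of `B` along `P*` is area-balanced** with the cell `(4,4)` inert: the
offsets return to `0` at the exit gate and stay in `[-1, 2]`. [folklore] -/
theorem offsetPstar_balanced : offsetPstar (Fin.last 24) = 0 ∧ ∀ i, -1 ≤ offsetPstar i ∧ offsetPstar i ≤ 2 := by
  constructor <;> decide

/-- Turn signs behind the balance: `7` right and `6` left turns, i.e. `6 + 6` besides the inert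
right turn. [folklore] -/
theorem pstar_fineStage_pairs :
    ((List.ofFn pstarTurns).map Turn.sign).sum = 1 ∧
      ((((List.ofFn pstarTurns).zipIdx.filter (fun q => q.2 ≠ 6)).map (fun q => q.1.sign)).sum = 0) := by
  decide

end ACMFigures

end QuasiSelfSimilar

end Literature.Analysis.FluidPDE
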